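import Mathlib.Analysis.SpecialFunctions.Sqrt

/-!
# Crux `ChessboardParticlePlanes.LjPlaneChessboard` (stmt-AtomisticToContinuum-6709), line `Sketch`,
# stub `sliceWeight_signChange` — the single sign change of the Lennard-Jones slice weight

The Lennard-Jones slice weight at in-plane wavenumber `q` and decay rate `λ`,
`W(q,λ) = (λ²-q²)√(λ²-q²)/144 - (λ²-q²)⁴√(λ²-q²)/43545600` (Yukawa mass `m = √(λ²-q²)`), changes
sign exactly once on `0 ≤ q ≤ λ`, at `m⁶ = (λ²-q²)³ = 302400 = 43545600/144`: it is `≥ 0` for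
`(λ²-q²)³ ≤ 302400` and `≤ 0` for `302400 ≤ (λ²-q²)³`.  [folklore]

PROOF.  `W(q,λ) = (λ²-q²)√(λ²-q²) · (302400 - (λ²-q²)³)/43545600` (`ring`, as
`144 · 302400 = 43545600`); the first factor is `≥ 0` (`0 ≤ λ²-q²` from `0 ≤ q ≤ λ`, and
`Real.sqrt_nonneg`), so the sign of `W` is that of `302400 - (λ²-q²)³`.  No definition is
introduced; the file depends only on Mathlib.
-/

noncomputable section

namespace Summit.AtomisticToContinuum.Crystallization.Theorems.ChessboardParticlePlanesLjPlaneChessboard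

/-- **Stub `sliceWeight_signChange` — the single sign change of the slice weight.**  For
`0 ≤ q ≤ λ`, the Lennard-Jones slice weight
`W(q,λ) = (λ²-q²)√(λ²-q²)/144 - (λ²-q²)⁴√(λ²-q²)/43545600` is nonnegative when
`(λ²-q²)³ ≤ 302400` and nonpositive when `302400 ≤ (λ²-q²)³`: factor
`W = (λ²-q²)√(λ²-q²) · (302400 - (λ²-q²)³)/43545600` with a nonnegative first factor.
[folklore] -/
theorem sliceWeight_signChange :
    ∀ (q l : ℝ), 0 ≤ q → q ≤ l →
      ((l ^ 2 - q ^ 2) ^ 3 ≤ 302400 →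
        0 ≤ (l ^ 2 - q ^ 2) * Real.sqrt (l ^ 2 - q ^ 2) / 144
              - (l ^ 2 - q ^ 2) ^ 4 * Real.sqrt (l ^ 2 - q ^ 2) / 43545600) ∧
      (302400 ≤ (l ^ 2 - q ^ 2) ^ 3 →
        (l ^ 2 - q ^ 2) * Real.sqrt (l ^ 2 - q ^ 2) / 144
              - (l ^ 2 - q ^ 2) ^ 4 * Real.sqrt (l ^ 2 - q ^ 2) / 43545600 ≤ 0) := by
  intro q l hq hql
  -- `0 ≤ λ² - q²` from `0 ≤ q ≤ λ`, hence `0 ≤ (λ²-q²)√(λ²-q²)`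
  have ht0 : 0 ≤ l ^ 2 - q ^ 2 := by nlinarith
  have hts0 : 0 ≤ (l ^ 2 - q ^ 2) * Real.sqrt (l ^ 2 - q ^ 2) :=
    mul_nonneg ht0 (Real.sqrt_nonneg _)
  -- the factorisation `W = (λ²-q²)√(λ²-q²) · (302400 - (λ²-q²)³) / 43545600`
  have key : (l ^ 2 - q ^ 2) * Real.sqrt (l ^ 2 - q ^ 2) / 144
      - (l ^ 2 - q ^ 2) ^ 4 * Real.sqrt (l ^ 2 - q ^ 2) / 43545600 =
      (l ^ 2 - q ^ 2) * Real.sqrt (l ^ 2 - q ^ 2) * (302400 - (l ^ 2 - q ^ 2) ^ 3)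
        / 43545600 := by
    ring
  rw [key]
  refine ⟨fun h => ?_, fun h => ?_⟩
  · -- light masses: both factors are nonnegative
    exact div_nonneg (mul_nonneg hts0 (sub_nonneg.2 h)) (by norm_num)
  · -- heavy masses: nonnegative times nonpositive
    exact div_nonpos_of_nonpos_of_nonneg
      (mul_nonpos_of_nonneg_of_nonpos hts0 (sub_nonpos.2 h)) (by norm_num)

end Summit.AtomisticToContinuum.Crystallization.Theorems.ChessboardParticlePlanesLjPlaneChessboard

end
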